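import Summits.CriticalPhenomena.CardyFormulaZ2.Theorems.CardyBoundaryCoulombGasHalfPlaneMarkDensityLawReduction
import Summits.CriticalPhenomena.CardyFormulaZ2.Theorems.CardyBoundaryCoulombGasHalfPlaneMarkDensityLawConverse

/-!
# Line `Sketch` — conclusion: the crux `HalfPlaneMarkDensityLaw` (stmt-CriticalPhenomena-5661) IS the
# collinear half-plane Cardy law C⁺ for bond-`ℤ²`

`stub_reduction` (C⁺ → crux) and `stub_converse` (crux → C⁺) combined (registered extra stub
`stub_equivalence`).  Reading for the planner: item 5 of route CardyBoundaryCoulombGas carries no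
content beyond the CDF statement C⁺ — the recorded failure mode "lattice-scale oscillation / local
ratio-limit" is VOID (the lattice mark density is `n⁻²`-Lipschitz by translation + the two-arm point
bound) — and C⁺ is the half-plane, collinear-marks case of Cardy's formula for critical bond percolation
on `ℤ²` (open; `⟸ RectilinearCardy`, stmt-CriticalPhenomena-5660, by box exhaustion).
-/

noncomputable section

namespace Summit.CriticalPhenomena.CardyFormulaZ2.Cruxes.HalfPlaneMarkDensityLaw.SketchLine

open Literature.Probability.Percolation Literature.Probability.LatticeModels
open MeasureTheory Filter Set
open scoped Topology
open Summit.CriticalPhenomena.CardyFormulaZ2.Theses.CardyBoundaryCoulombGas (HalfPlaneMarkDensityLaw)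
open Summit.CriticalPhenomena.CardyFormulaZ2.Theorems.HalfPlaneMarkDensityLaw.Negative

/-- **The crux is equivalent to the collinear half-plane Cardy law** (registered extra stub
`stub_equivalence`). [folklore] -/
theorem stub_equivalence :
    HalfPlaneMarkDensityLaw ↔ ∀ a b c y : ℝ, a < b → b < c → c < y →
      Tendsto (fun n : ℕ ↦ μ.real (openCrossing halfPlane (arcA a b n) (rowIcc ⌊c * n⌋ ⌊y * n⌋))) atTop
        (𝓝 (Literature.Probability.RandomPlanarGeometry.cardyFunction
          (Literature.Probability.RandomPlanarGeometry.crossRatio ![a, b, c, y]))) :=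
  ⟨stub_converse, stub_reduction⟩

end Summit.CriticalPhenomena.CardyFormulaZ2.Cruxes.HalfPlaneMarkDensityLaw.SketchLine
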